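import Summits.MatrixMultiplication.MatrixMultiplication.Theses.WindowedCompletionRank
import Summits.MatrixMultiplication.MatrixMultiplication.Theorems.WindowedCompletionRankHadamardRankLe
import Summits.MatrixMultiplication.MatrixMultiplication.Theorems.NOFWindowCapacityAddTableRankLe
import Summits.MatrixMultiplication.MatrixMultiplication.Theorems.WindowedCompletionRankAssembly
import Literature.Computability.AlgebraicComplexity.MatMulRankLowerBoundsBlaserProofs
import Literature.Computability.AlgebraicComplexity.TwoByTwoRankLowerBound

/-!
# `WindowedCompletionRank.Thesis` (crux stmt-MatrixMultiplication-5491): no single level, no uniform witness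

Negative-side support file of the refuter's crux attack (one cycle, 2026-08-17); `sorry`-free.
The crux `Thesis` (graded completion rank: for every `ε > 0` a presentation of `⟨n,n,n⟩`, `n ≥ 2`,
as a restriction of the windowed Hadamard product `[α b + β c = γ a]·S(γ a, α b, β c)` over a
finite abelian `G` with `|G| ≤ n^(2+ε)` and `R(S) ≤ n^ε`) SURVIVES the basic attacks; what is
recorded here is the calibration of its quantifier structure:

Write `Body n ε` for the matrix of the crux (`G, α, β, γ, S` with `|G| ≤ n^(2+ε)`, `R(S) ≤ n^ε`,
`⟨n,n,n⟩ ≤ window`), so that `Thesis` is literally `∀ ε > 0, ∃ n ≥ 2, Body n ε` (no auxiliary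
definition is introduced; every statement below spells the body out verbatim).

* `sq_lt_tensorRank_matMulTensor` — `n² < R(⟨n,n,n⟩)` for `n ≥ 2` (tree: `R(⟨2,2,2⟩) ≥ 7`,
  Bläser's `R(⟨n,n,n⟩) ≥ 5/2 n² − 3n`).
* `sq_lt_card_mul_tensorRank` — every windowed presentation of `⟨n,n,n⟩`, `n ≥ 2`, has
  `n² < |G|·R(S)` (the route's proved chain `R(⟨n,n,n⟩) ≤ |G|·R(S)` plus the strict flattening
  bound).
* `thesis_at_zero_false` — `∃ n ≥ 2, Body n 0` is FALSE (`|G| ≤ n²`, `R(S) ≤ 1` would give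
  `R(⟨n,n,n⟩) ≤ n²`): the hypothesis `0 < ε` of the crux is load-bearing, and no single
  presentation certifies exponent `2` (the route's `InfimumNotMinimumBarrier` instance, in Lean).
* `thesis_uniform_false` — the quantifier swap `∃ n ≥ 2, ∃ (G, α, β, γ, S), ∀ ε > 0, …` is FALSE
  (letting `ε → 0⁺` in the two real bounds lands in `Body n 0`): the family
  `ε ↦ (n_ε, G_ε, S_ε)` is essential and `|G_ε|·R(S_ε) → ∞`, hence `n_ε → ∞`, is forced.
* `thesis_body_of_one_le`, `thesis_variant_one_le` — boundary calibration: for `ε ≥ 1` the level IS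
  attained at every `n ≥ 2`, by the collision-free coordinate frame `G = (Fin n)³`, `S ≡ 1` (window =
  support of `⟨n,n,n⟩`, the abelian TPP regime `|G| = n³`); so the crux is non-vacuous, monotone in
  `ε`, and its entire content is the regime `ε < 1` (beating `|G|·R(S) = n³`), open below
  `ε ≈ ω/3` (delegation, `DelegationBound`) in the route's own accounting.
-/

-- single-problem summit: `Summit.MatrixMultiplication.MatrixMultiplication.…` is the mandated namespace
set_option linter.dupNamespace false

namespace Summit.MatrixMultiplication.MatrixMultiplication.Theorems.Thesis.Negative

open Filter Topology
open Literature.Computability.AlgebraicComplexity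
open Summit.MatrixMultiplication.MatrixMultiplication.Theorems

/-- Strict flattening bound: `n² < R(⟨n,n,n⟩)` over `ℂ` for every `n ≥ 2` (from the tree's
`R(⟨2,2,2⟩) ≥ 7` and Bläser's `R(⟨n,n,n⟩) ≥ 5/2·n² − 3n`). -/
theorem sq_lt_tensorRank_matMulTensor (n : ℕ) (hn : 2 ≤ n) :
    n ^ 2 < tensorRank (matMulTensor ℂ n n n) := by
  rcases Nat.lt_or_ge n 3 with h3 | h3
  · obtain rfl : n = 2 := by omega
    have h7 := seven_le_tensorRank_matMulTensor_two ℂ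
    omega
  · have hB := Blaser1999_rank_lower_bound_holds ℂ n
    have hn3 : (3 : ℝ) ≤ n := by exact_mod_cast h3
    have hlt : ((n ^ 2 : ℕ) : ℝ) < (tensorRank (matMulTensor ℂ n n n) : ℝ) := by
      push_cast
      nlinarith
    exact_mod_cast hlt

/-- Every windowed presentation is strictly super-quadratic in cost: if `⟨n,n,n⟩`, `n ≥ 2`, is a
restriction of `[α b + β c = γ a]·S(γ a, α b, β c)` over a finite abelian `G`, then
`n² < |G|·R(S)` (the route's proved chain `R(⟨n,n,n⟩) ≤ |G|·R(S)` — Hadamard submultiplicativity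
and `R(U_G) ≤ |G|`, both landed — under the strict flattening bound). -/
theorem sq_lt_card_mul_tensorRank {n : ℕ} (hn : 2 ≤ n) {G : Type} [AddCommGroup G] [Fintype G]
    [DecidableEq G] (α β γ : Fin n × Fin n → G) (S : G → G → G → ℂ)
    (hres : TensorRestrictsTo
      (fun a b c : Fin n × Fin n => if α b + β c = γ a then S (γ a) (α b) (β c) else 0)
      (matMulTensor ℂ n n n)) :
    n ^ 2 < Fintype.card G * tensorRank S :=
  lt_of_lt_of_le (sq_lt_tensorRank_matMulTensor n hn)
    (windowedCompletionRank_tensorRank_matMul_le_card_mul hadamardRankLe_proof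
      windowedCompletionRank_addTableRankLe_proof α β γ S hres)

/-- **No single level.** The crux at `ε = 0` (its body with `ε := 0`, verbatim) is false: `|G| ≤ n²` and `R(S) ≤ 1` would give
`R(⟨n,n,n⟩) ≤ |G|·R(S) ≤ n²`, against `n² < R(⟨n,n,n⟩)`. So `0 < ε` is load-bearing in `Thesis`, and a
single presentation never certifies exponent `2` — only a family `ε → 0` can. -/
theorem thesis_at_zero_false :
    ¬ ∃ n : ℕ, 2 ≤ n ∧ ∃ (G : Type) (_ : AddCommGroup G) (_ : Fintype G) (_ : DecidableEq G),
      (Fintype.card G : ℝ) ≤ (n : ℝ) ^ (2 + (0 : ℝ)) ∧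
      ∃ (α β γ : Fin n × Fin n → G) (S : G → G → G → ℂ),
        (tensorRank S : ℝ) ≤ (n : ℝ) ^ (0 : ℝ) ∧
        TensorRestrictsTo
          (fun a b c : Fin n × Fin n => if α b + β c = γ a then S (γ a) (α b) (β c) else 0)
          (matMulTensor ℂ n n n) := by
  rintro ⟨n, hn, G, instG, instF, instD, hcard, α, β, γ, S, hS, hres⟩
  have hlt := sq_lt_card_mul_tensorRank hn α β γ S hres
  rw [add_zero, Real.rpow_two] at hcard
  rw [Real.rpow_zero] at hS
  have h1 : (Fintype.card G : ℝ) * (tensorRank S : ℝ) ≤ (n : ℝ) ^ 2 * 1 :=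
    mul_le_mul hcard hS (Nat.cast_nonneg _) (by positivity)
  have h2 : ((n ^ 2 : ℕ) : ℝ) < ((Fintype.card G * tensorRank S : ℕ) : ℝ) := by exact_mod_cast hlt
  push_cast at h2
  linarith

/-- **No uniform witness (the quantifier swap is false).** No single `(n, G, α, β, γ, S)` serves
every `ε > 0`: the bounds `|G| ≤ n^(2+ε)`, `R(S) ≤ n^ε` for all `ε > 0` force `|G| ≤ n²`,
`R(S) ≤ 1` (let `ε → 0⁺`), i.e. the false level `ε = 0`. Any proof of `Thesis` must produce a
genuine family with `n_ε → ∞`. -/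
theorem thesis_uniform_false :
    ¬ ∃ n : ℕ, 2 ≤ n ∧ ∃ (G : Type) (_ : AddCommGroup G) (_ : Fintype G) (_ : DecidableEq G)
      (α β γ : Fin n × Fin n → G) (S : G → G → G → ℂ), ∀ ε : ℝ, 0 < ε →
        (Fintype.card G : ℝ) ≤ (n : ℝ) ^ (2 + ε) ∧ (tensorRank S : ℝ) ≤ (n : ℝ) ^ ε ∧
        TensorRestrictsTo
          (fun a b c : Fin n × Fin n => if α b + β c = γ a then S (γ a) (α b) (β c) else 0)
          (matMulTensor ℂ n n n) := by
  rintro ⟨n, hn, G, instG, instF, instD, α, β, γ, S, h⟩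
  have hn0 : (n : ℝ) ≠ 0 := by exact_mod_cast (show n ≠ 0 by omega)
  have t1 : Tendsto (fun ε : ℝ => (n : ℝ) ^ (2 + ε)) (𝓝[>] 0) (𝓝 ((n : ℝ) ^ (2 + (0 : ℝ)))) := by
    have hc : Continuous (fun ε : ℝ => (n : ℝ) ^ (2 + ε)) :=
      (Real.continuous_const_rpow hn0).comp (continuous_const.add continuous_id)
    exact (hc.tendsto 0).mono_left nhdsWithin_le_nhds
  have t2 : Tendsto (fun ε : ℝ => (n : ℝ) ^ ε) (𝓝[>] 0) (𝓝 ((n : ℝ) ^ (0 : ℝ))) :=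
    ((Real.continuous_const_rpow hn0).tendsto 0).mono_left nhdsWithin_le_nhds
  have hcard : (Fintype.card G : ℝ) ≤ (n : ℝ) ^ (2 + (0 : ℝ)) :=
    ge_of_tendsto t1 (eventually_nhdsWithin_of_forall fun ε hε => (h ε hε).1)
  have hS : (tensorRank S : ℝ) ≤ (n : ℝ) ^ (0 : ℝ) :=
    ge_of_tendsto t2 (eventually_nhdsWithin_of_forall fun ε hε => (h ε hε).2.1)
  exact thesis_at_zero_false ⟨n, hn, G, instG, instF, instD, hcard, α, β, γ, S, hS, (h 1 one_pos).2.2⟩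

/-- **Boundary calibration: the level `ε ≥ 1` is attained** at every `n ≥ 2`, by the collision-free
coordinate frame `G = (Fin n)³`, `α b = (b.1, b.2, 0)`, `β c = (0, -c.1, c.2)`, `γ a = (a.1, 0, a.2)`
(the window `α b + β c = γ a` is exactly the support of `⟨n,n,n⟩`) and `S ≡ 1`:
`|G| = n³ ≤ n^(2+ε)`, `R(S) ≤ 1 ≤ n^ε`, and the window tensor IS `⟨n,n,n⟩`. -/
theorem thesis_body_of_one_le (n : ℕ) (hn : 2 ≤ n) (ε : ℝ) (hε : 1 ≤ ε) :
    ∃ (G : Type) (_ : AddCommGroup G) (_ : Fintype G) (_ : DecidableEq G),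
      (Fintype.card G : ℝ) ≤ (n : ℝ) ^ (2 + ε) ∧
      ∃ (α β γ : Fin n × Fin n → G) (S : G → G → G → ℂ),
        (tensorRank S : ℝ) ≤ (n : ℝ) ^ ε ∧
        TensorRestrictsTo
          (fun a b c : Fin n × Fin n => if α b + β c = γ a then S (γ a) (α b) (β c) else 0)
          (matMulTensor ℂ n n n) := by
  haveI : NeZero n := ⟨by omega⟩
  have hn1 : (1 : ℝ) ≤ n := by exact_mod_cast (le_trans (by norm_num) hn)
  refine ⟨Fin n × Fin n × Fin n, inferInstance, inferInstance, inferInstance, ?_,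
    fun b => (b.1, b.2, 0), fun c => (0, -c.1, c.2), fun a => (a.1, 0, a.2), fun _ _ _ => 1, ?_, ?_⟩
  · have hcard : (Fintype.card (Fin n × Fin n × Fin n) : ℝ) = (n : ℝ) ^ (3 : ℝ) := by
      rw [show (3 : ℝ) = ((3 : ℕ) : ℝ) by norm_num, Real.rpow_natCast]
      simp [Fintype.card_prod, Fintype.card_fin]
      ring
    rw [hcard]
    exact Real.rpow_le_rpow_of_exponent_le hn1 (by linarith)
  · have h1 : tensorRank (fun (_ _ _ : Fin n × Fin n × Fin n) => (1 : ℂ)) ≤ 1 := by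
      refine tensorRank_le_of_eq_sum (fun _ _ => 1) (fun _ _ => 1) (fun _ _ => 1) ?_
      funext g u v
      simp [triad]
    calc (tensorRank (fun (_ _ _ : Fin n × Fin n × Fin n) => (1 : ℂ)) : ℝ) ≤ 1 := by
          exact_mod_cast h1
      _ ≤ (n : ℝ) ^ ε := Real.one_le_rpow hn1 (by linarith)
  · have key : ∀ a b c : Fin n × Fin n,
        ((b.1, b.2, (0 : Fin n)) + ((0 : Fin n), -c.1, c.2) = (a.1, (0 : Fin n), a.2)) ↔
          (a.1 = b.1 ∧ b.2 = c.1 ∧ a.2 = c.2) := by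
      intro a b c
      simp only [Prod.mk_add_mk, add_zero, zero_add, Prod.mk.injEq, add_neg_eq_zero]
      constructor
      · rintro ⟨h1, h2, h3⟩
        exact ⟨h1.symm, h2, h3.symm⟩
      · rintro ⟨h1, h2, h3⟩
        exact ⟨h1.symm, h2, h3.symm⟩
    have hW : (fun a b c : Fin n × Fin n =>
        if (b.1, b.2, (0 : Fin n)) + ((0 : Fin n), -c.1, c.2) = (a.1, (0 : Fin n), a.2) then (1 : ℂ)
        else 0) = matMulTensor ℂ n n n := by
      funext a b c
      by_cases h : a.1 = b.1 ∧ b.2 = c.1 ∧ a.2 = c.2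
      · have h' := (key a b c).2 h
        rw [if_pos h']
        simp [matMulTensor, h]
      · have h' : ¬ ((b.1, b.2, (0 : Fin n)) + ((0 : Fin n), -c.1, c.2) = (a.1, (0 : Fin n), a.2)) :=
          fun h'' => h ((key a b c).1 h'')
        rw [if_neg h']
        simp [matMulTensor, h]
    rw [hW]
    exact TensorRestrictsTo.refl _

/-- Hence the crux with `0 < ε` replaced by `1 ≤ ε` is a theorem (take `n = 2`): `Thesis` is
non-vacuous, the set of attained levels `ε` is an up-set containing `[1, ∞)` and (by
`thesis_at_zero_false`) not `0`; `Thesis` asserts that its infimum is `0`. -/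
theorem thesis_variant_one_le :
    ∀ ε : ℝ, 1 ≤ ε → ∃ n : ℕ, 2 ≤ n ∧ ∃ (G : Type) (_ : AddCommGroup G) (_ : Fintype G)
      (_ : DecidableEq G), (Fintype.card G : ℝ) ≤ (n : ℝ) ^ (2 + ε) ∧
      ∃ (α β γ : Fin n × Fin n → G) (S : G → G → G → ℂ),
        (tensorRank S : ℝ) ≤ (n : ℝ) ^ ε ∧
        TensorRestrictsTo
          (fun a b c : Fin n × Fin n => if α b + β c = γ a then S (γ a) (α b) (β c) else 0)
          (matMulTensor ℂ n n n) :=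
  fun ε hε => ⟨2, le_rfl, thesis_body_of_one_le 2 le_rfl ε hε⟩

end Summit.MatrixMultiplication.MatrixMultiplication.Theorems.Thesis.Negative
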